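import Summits.NavierStokesRegularity.NavierStokesRegularity.Theorems.ExtremiserTransienceKStarAttainedHalfSpaceComposition
import Mathlib.Analysis.SpecialFunctions.SmoothTransition
import Mathlib.Analysis.Calculus.Deriv.Slope
import HarnessLib

/-!
# Crux `ExtremiserTransience.NearExtremalTransience` (stmt-NavierStokesRegularity-21883), line `extremiser_liouville`,
# stub K1b `stub_noAnalyticExtremal` — «NO GAIN FROM CONSTANTS», file 1/5: THE LOG-FLAT RADIAL CUT-OFF

`--supports stmt-NavierStokesRegularity-21883` (helper).  Author: prover seat `ns-el-k1b` (g0).  The five files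
`…ExtremiserLiouville{LogFlatCutoff, ConstantCarrier, Densities, ArrayField, NoGainFromConstants}` prove the «ONE new variational fact»
named by the line card of `extremiser_liouville` (ns-idea-10 g2, critic idea-crit-8 V21) as the first lemma of K1b:
**constants never raise the stretching efficiency above `κ⋆`** — for `u ∈ C^∞_c` divergence free and any constant `b`,
`|∫⟪ω, Du ω⟫| ≤ κ⋆ · ‖u + b‖_∞ · ‖ω‖₂ · ‖∇ω‖₂` (main theorem `noGainFromConstants`, file 5/5).

THIS FILE: the cut-off `χ(x) = σ(1 − log ‖x‖² / K)` (`σ` = Mathlib's `Real.smoothTransition`, `K = sup|σ'| > 0`):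
`χ = 1` on the closed unit ball (`logCutoff_eq_one`), `χ = 0` for `‖x‖² ≥ e^K` (`logCutoff_eq_zero`), `0 ≤ χ ≤ 1`, `χ` is
`C^∞` (`contDiff_logCutoff`), and off the origin `∇χ(x) = c(x)·x` (`hasFDerivAt_logCutoff`) with the FLATNESS bound
`−1 ≤ c(x)‖x‖²/2 ≤ 0` (`flat_bounds`) — i.e. `r|χ'(r)| ≤ 2`.  The logarithmic reparametrisation is what makes the radial
derivative small uniformly at every scale; it is the reason the constant carrier of file 2/5 never overshoots `‖b‖`.

WHAT THIS IS NOT: pure calculus; K1b is a STATIC statement about analytic κ⋆-efficient fields; the crux NET, rung N0 and NS regularity stay OPEN — nothing here proves NS regularity. [folklore]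
-/

noncomputable section

open Set Filter Topology MeasureTheory Metric
open scoped InnerProductSpace RealInnerProductSpace ENNReal NNReal ContDiff
open Literature.Analysis.FluidPDE

namespace Summit.NavierStokesRegularity.NavierStokesRegularity.Theorems

-- the problem directory repeats the summit name (`NavierStokesRegularity/NavierStokesRegularity`)
set_option linter.dupNamespace false

namespace ExtremiserLiouville

open DepletionLadder.KStar.HalfSpace (E3)

/-! ## The log-flat cut-off -/

/-- A global bound `D > 0` on `|σ'|`, `σ = Real.smoothTransition` (`σ' = 0` off `[0,1]`, continuous on `[0,1]`). [folklore] -/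
theorem exists_bound_deriv_smoothTransition :
    ∃ D : ℝ, 0 < D ∧ ∀ t : ℝ, |deriv Real.smoothTransition t| ≤ D := by
  have hc : Continuous (deriv Real.smoothTransition) :=
    (Real.smoothTransition.contDiff (n := 1)).continuous_deriv le_rfl
  obtain ⟨C, hC⟩ := (isCompact_Icc : IsCompact (Icc (0:ℝ) 1)).exists_bound_of_continuousOn hc.continuousOn
  refine ⟨max C 1, lt_of_lt_of_le one_pos (le_max_right _ _), fun t => ?_⟩
  by_cases ht : t ∈ Icc (0:ℝ) 1
  · have h := hC t ht
    rw [Real.norm_eq_abs] at h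
    exact h.trans (le_max_left _ _)
  · have h0 : deriv Real.smoothTransition t = 0 := by
      rw [mem_Icc, not_and_or, not_le, not_le] at ht
      rcases ht with ht | ht
      · have h : Real.smoothTransition =ᶠ[𝓝 t] fun _ => (0:ℝ) := by
          filter_upwards [Iio_mem_nhds ht] with s hs using Real.smoothTransition.zero_of_nonpos hs.le
        rw [h.deriv_eq, deriv_const]
      · have h : Real.smoothTransition =ᶠ[𝓝 t] fun _ => (1:ℝ) := by
          filter_upwards [Ioi_mem_nhds ht] with s hs using Real.smoothTransition.one_of_one_le hs.le
        rw [h.deriv_eq, deriv_const]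
    rw [h0, abs_zero]
    exact le_trans zero_le_one (le_max_right _ _)

/-- The flatness constant `K = sup|σ'|` (a fixed positive real). -/
def flatK : ℝ := Classical.choose exists_bound_deriv_smoothTransition

/-- Auxiliary (`flatK_pos`). [folklore] -/
theorem flatK_pos : 0 < flatK := (Classical.choose_spec exists_bound_deriv_smoothTransition).1

/-- Auxiliary (`abs_deriv_le_flatK`). [folklore] -/
theorem abs_deriv_le_flatK (t : ℝ) : |deriv Real.smoothTransition t| ≤ flatK :=
  (Classical.choose_spec exists_bound_deriv_smoothTransition).2 t

/-- **The log-flat radial cut-off** `χ(x) = σ(1 − log ‖x‖² / K)`: `= 1` on the closed unit ball, `= 0` for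
`‖x‖² ≥ e^K`, values in `[0,1]`, and `‖x‖·|∇χ(x)| ≤ 2/K · sup|σ'| = 2`. -/
def logCutoff (x : E3) : ℝ := Real.smoothTransition (1 - Real.log (‖x‖ ^ 2) / flatK)

/-- Auxiliary (`logCutoff_nonneg`). [folklore] -/
theorem logCutoff_nonneg (x : E3) : 0 ≤ logCutoff x := Real.smoothTransition.nonneg _

/-- Auxiliary (`logCutoff_le_one`). [folklore] -/
theorem logCutoff_le_one (x : E3) : logCutoff x ≤ 1 := Real.smoothTransition.le_one _

/-- `χ = 1` on the closed unit ball. [folklore] -/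
theorem logCutoff_eq_one {x : E3} (hx : ‖x‖ ≤ 1) : logCutoff x = 1 := by
  unfold logCutoff
  apply Real.smoothTransition.one_of_one_le
  have h1 : Real.log (‖x‖ ^ 2) ≤ 0 :=
    Real.log_nonpos (sq_nonneg _) (by nlinarith [norm_nonneg x])
  have h2 : Real.log (‖x‖ ^ 2) / flatK ≤ 0 := div_nonpos_of_nonpos_of_nonneg h1 flatK_pos.le
  linarith

/-- `χ = 0` where `‖x‖² ≥ e^K`. [folklore] -/
theorem logCutoff_eq_zero {x : E3} (hx : Real.exp flatK ≤ ‖x‖ ^ 2) : logCutoff x = 0 := by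
  unfold logCutoff
  apply Real.smoothTransition.zero_of_nonpos
  have h1 : flatK ≤ Real.log (‖x‖ ^ 2) := by
    rw [← Real.log_exp flatK]
    exact Real.log_le_log (Real.exp_pos _) hx
  have h2 : 1 ≤ Real.log (‖x‖ ^ 2) / flatK := by
    rw [le_div_iff₀ flatK_pos, one_mul]; exact h1
  linarith

/-- The gradient coefficient `c(x) = −2σ'(1 − log‖x‖²/K) / (K‖x‖²)` (so `∇χ(x) = c(x)·x`). -/
def gradCoeff (x : E3) : ℝ :=
  -(2 * deriv Real.smoothTransition (1 - Real.log (‖x‖ ^ 2) / flatK) / (flatK * ‖x‖ ^ 2))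

/-- **`∇χ(x) = c(x)·x` off the origin.** [folklore] -/
theorem hasFDerivAt_logCutoff {x : E3} (hx : x ≠ 0) :
    HasFDerivAt logCutoff (innerSL ℝ (gradCoeff x • x)) x := by
  have hx2 : ‖x‖ ^ 2 ≠ 0 := pow_ne_zero 2 (norm_ne_zero_iff.2 hx)
  have h1 : HasFDerivAt (fun y : E3 => ‖y‖ ^ 2) ((2:ℝ) • innerSL ℝ x) x := by
    have h := (hasStrictFDerivAt_norm_sq x).hasFDerivAt
    rw [← Nat.cast_smul_eq_nsmul ℝ, Nat.cast_ofNat] at h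
    exact h
  have h2 : HasFDerivAt (fun y : E3 => Real.log (‖y‖ ^ 2)) ((‖x‖ ^ 2)⁻¹ • ((2:ℝ) • innerSL ℝ x)) x := h1.log hx2
  have hfun : (fun y : E3 => 1 - Real.log (‖y‖ ^ 2) / flatK) = fun y => 1 - flatK⁻¹ * Real.log (‖y‖ ^ 2) := by
    funext y; rw [div_eq_inv_mul]
  have h3 : HasFDerivAt (fun y : E3 => 1 - Real.log (‖y‖ ^ 2) / flatK)
      (-(flatK⁻¹ • ((‖x‖ ^ 2)⁻¹ • ((2:ℝ) • innerSL ℝ x)))) x := by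
    rw [hfun]
    exact (h2.const_mul flatK⁻¹).const_sub 1
  have hσ : HasDerivAt Real.smoothTransition
      (deriv Real.smoothTransition (1 - Real.log (‖x‖ ^ 2) / flatK)) (1 - Real.log (‖x‖ ^ 2) / flatK) :=
    ((Real.smoothTransition.contDiff (n := 1)).differentiable (by simp) _).hasDerivAt
  have h4 := hσ.comp_hasFDerivAt x h3
  have heq : deriv Real.smoothTransition (1 - Real.log (‖x‖ ^ 2) / flatK) •
      (-(flatK⁻¹ • ((‖x‖ ^ 2)⁻¹ • ((2:ℝ) • innerSL ℝ x)))) = innerSL ℝ (gradCoeff x • x) := by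
    rw [map_smul, smul_neg, smul_smul, smul_smul, smul_smul, ← neg_smul]
    congr 1
    unfold gradCoeff
    ring
  rw [← heq]
  exact h4

/-- The flatness bound: `s = c‖x‖²/2 = −σ'/K ∈ [−1, 0]`. [folklore] -/
theorem gradCoeff_mul_norm_sq {x : E3} (hx : x ≠ 0) :
    gradCoeff x * ‖x‖ ^ 2 / 2 = -(deriv Real.smoothTransition (1 - Real.log (‖x‖ ^ 2) / flatK) / flatK) := by
  have hx2 : ‖x‖ ^ 2 ≠ 0 := pow_ne_zero 2 (norm_ne_zero_iff.2 hx)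
  unfold gradCoeff
  have hK := flatK_pos.ne'
  field_simp

/-- Auxiliary (`flat_bounds`): `−1 ≤ s ≤ 0` for `s = c‖x‖²/2`. [folklore] -/
theorem flat_bounds {x : E3} (hx : x ≠ 0) :
    -1 ≤ gradCoeff x * ‖x‖ ^ 2 / 2 ∧ gradCoeff x * ‖x‖ ^ 2 / 2 ≤ 0 := by
  rw [gradCoeff_mul_norm_sq hx]
  set d := deriv Real.smoothTransition (1 - Real.log (‖x‖ ^ 2) / flatK)
  have hd0 : 0 ≤ d := Real.smoothTransition.monotone.deriv_nonneg
  have hdK : d ≤ flatK := (le_abs_self d).trans (abs_deriv_le_flatK _)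
  have hK := flatK_pos
  constructor
  · rw [neg_le_neg_iff, div_le_one hK]; exact hdK
  · rw [neg_nonpos]; exact div_nonneg hd0 hK.le

/-- **`χ` is `C^∞`** (composition off the origin; locally constant `= 1` near the origin). [folklore] -/
theorem contDiff_logCutoff : ContDiff ℝ ∞ logCutoff := by
  rw [contDiff_iff_contDiffAt]
  intro x
  by_cases hx : ‖x‖ < 1
  · -- locally constant
    have hev : logCutoff =ᶠ[𝓝 x] fun _ => (1:ℝ) := by
      filter_upwards [Metric.isOpen_ball.mem_nhds (mem_ball_zero_iff.2 hx)] with y hy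
      exact logCutoff_eq_one (mem_ball_zero_iff.1 hy).le
    exact (contDiffAt_const.congr_of_eventuallyEq hev)
  · have hx0 : x ≠ 0 := by
      intro h; rw [h, norm_zero] at hx; exact hx one_pos
    have hx2 : ‖x‖ ^ 2 ≠ 0 := pow_ne_zero 2 (norm_ne_zero_iff.2 hx0)
    have h1 : ContDiffAt ℝ ∞ (fun y : E3 => ‖y‖ ^ 2) x := (contDiff_norm_sq ℝ).contDiffAt
    have h2 : ContDiffAt ℝ ∞ (fun y : E3 => Real.log (‖y‖ ^ 2)) x := h1.log hx2
    have h3 : ContDiffAt ℝ ∞ (fun y : E3 => 1 - Real.log (‖y‖ ^ 2) / flatK) x :=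
      contDiffAt_const.sub (h2.div_const _)
    exact Real.smoothTransition.contDiff.contDiffAt.comp x h3

end ExtremiserLiouville

end Summit.NavierStokesRegularity.NavierStokesRegularity.Theorems

end
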